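import Literature.MathematicalPhysics.QuantumFieldTheory.Balaban1983to89.B8Thm2TorusKnitOfCubeDataCatalogued
import Literature.MathematicalPhysics.QuantumFieldTheory.Balaban1983to89.B9B8KnitTorusSocketCatalogued
import Literature.MathematicalPhysics.QuantumFieldTheory.Balaban1983to89.B8Eq159TorusPerOfSockB9P3Per
import Literature.MathematicalPhysics.QuantumFieldTheory.Balaban1983to89.B8Thm2T3FamilyBinder

/-!
# `Balaban1983to89.B8Thm2TorusOfCubeDataDeltaASide` — sub-row G-B8-T2S, file G3: [Balaban1985RegularSpaces] THEOREM 2 ON THE TORUS `T_η` FOR `SU(N)` — THE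
# ENDPOINT OF RECORD OF THE TORUS ASSEMBLER, displayed modulo EXACTLY TWO analytic families: (α) the per-cube (3.35) data of the background ([B8] (1.33)'s own
# second clause «U₀ satisfies the regularity condition (3.35) in [4]», [B9] (3.35)–(3.37) p. 396) and (Δa) the six Δ_a-side members of [B9] §3 at def-Y's letters
# (Thm 3.3 ∕ 3.4 ∕ 3.11: `Δ_a(U)` invertible with the three weighted bounds of `G(U) = Δ_a(U)⁻¹`, `Δ′_a(U)` and `X(U)` invertible) — the member catalogue, the
# [B9] Thm 3.1 ∕ 3.2 majorants, the (B)-lines ∕ Prop. 3 socket, the averaging junction and all windows being THEOREMS upstream (G2 = FILE 16′ ∘ G1; g8 F10; r05's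
# guarded arrow)

statement-level skeleton of published theorems with citation tags; proofs where landed; nothing here is a claim about the
Yang–Mills mass gap

T. Bałaban, *Spaces of regular gauge field configurations on a lattice and gauge fixing conditions*, Commun. Math. Phys. **99** (1985) 75–102
[`Balaban1985RegularSpaces`, "[B8]"]: Thm 2 p. 83 («There exist constants B₁, B₂(β₀), c₁ such that for arbitrary U₀, U′U₀ satisfying (1.33)–(1.35) with α₀ + α₁ ≦ c₁
there exists exactly one gauge transformation u satisfying (1.29) and such that the conditions (1.36)–(1.39) hold for the configuration U₁ = U′^{u⁻¹}»),
(1.33)–(1.39) pp. 82–83, p. 77 («Ω_j = T_η for j = 0,1,…,l, l ≤ k»), p. 76 («G = SU(N)»), Prop. 3 (1.58)–(1.60) pp. 86–87.  T. Bałaban, *Propagators for lattice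
gauge theories in a background field*, Commun. Math. Phys. **99** (1985) 389–434 [`Balaban1985BackgroundPropagators`, "[B9]"]: (3.35)–(3.37) p. 396, Thm 3.1
(3.42) p. 397, Thm 3.2 (3.48) p. 398, Thm 3.3 p. 399, Thm 3.4 p. 400, (3.16) p. 393, (3.41) p. 397, (3.69) p. 404, Thm 3.7 pp. 409–410, Thm 3.9 p. 413, Thm 3.11
p. 416.  [4] = T. Bałaban, *Propagators and renormalization transformations for lattice gauge theories. II*, Commun. Math. Phys. **96** (1984) 223–250
[`Balaban1984PropagatorsII`]: (2.1)–(2.4) p. 224, (2.16) p. 225, Lemma 2.1 pp. 233–234.  T. Bałaban, *Averaging operations for lattice gauge theories*, Commun.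
Math. Phys. **98** (1985) 17–51 [`Balaban1985Averaging`, "[B7]"]: (4) p. 18, Prop. 2 p. 26.  [Balaban1985UV3] (1)–(3) p. 256 (the `T3Family` torus).

WHY ∕ THE ARGUMENT.  G2 `B8Thm2TorusKnitOfCubeDataCatalogued.thm2SetupSUAt_ofCubeData_catalogued_exists` proves `Thm2SetupSUAt (PV d ℓ m K) N k η 0 B₁ B₂ c₁ len ⊤`
from (α) the per-cube (3.35) data (member-generic) and (iii) the (B)-lines `B9P3PerAt` at every `m′ ≤ k`, for any (B)-line constants `B₀ ≥ 2∕(5(d+1)L)`, `B₀β`,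
`c_B9 > 0`, `β_H`.  r05's guarded arrow `B8Eq159TorusPerOfSockB9P3Per.b9Arrow_of_sockB9P3Per` gives (iii) from pub-ymgap's shared socket
`∀ m′ ≤ k, SockB9P3Per P₀ L B₀ B₀β c_P β len η m′ {ℤ^{d+1}} torusLam torusLamb` at any radius `c_L ≤ c_P`, and seat t2s-1 g8's F10
`B9B8KnitTorusSocketCatalogued.sockB9P3Per_torus_allLevels_catalogued` gives that socket at the constant set `B* = max (max 1 (4B₀·max 1 q_Q)) (max 2 (4(d+1)))`,
`C* = max (2·max 0 (4B₀)·max 1 q_Q) 4`, `c_P = min (1∕16) (min a_T (min a_T (1∕(4B₀·14d·M + 1))))`, `β = 0` FROM (Δa) the six Δ_a-side members at every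
shape-member `i : KIdx d ℓ hd hL 1 1` of level `1 ≤ m′ ≤ k` (the members chosen inside F10 from g7's weighted catalogue at band `b₀ = b₁ = 1`), the windows on `a_T`
and ONE numeric condition, under the volume slack `k + 5 ≤ m + K` (`L² ≥ 8`).  This file composes the three at band `b₀ = b₁ = 1` (so that (α) and (Δa) range over
the SAME index type), with the abstract letters parameter `ops₀` of the socket machinery instantiated trivially (the socket's statement does not mention it) and
`B₁ = 5(d+1)L·B*·(1 + 11(d+1)²) + 1`; §2 reads the result in the 19200 dictionary's `T3Family` vocabulary (`d + 1 = 3`, `N = 2`, `L = F.L`, `k = K − n`,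
`η = L^{−(K−n)}`, `F.P K = PV 2 ℓ F.m K` by A13's `P_eq_PV`).

WHAT IS PROVED (kernel; 0 `def`, 0 `… : Prop` fact, 0 sorry; standard axioms).
* §1 ★★★★★ `thm2SetupSUAt_ofCubeData_deltaASide_exists` — for `1 ≤ N ≤ 25`, `d + 1 ≥ 2`, odd `L = ℓ + 1 ≥ 5`, the trace form `τ = tr` with its constant `C_τ`,
  a weighted-bound constant `B₀ > 0`, a block parameter `M ≥ 1`, a threshold `a_T` in the windows (`0 < a_T ≤ α_Q∕L²`, `C₀(d+1)a_T ≤ 1∕3`, `2a_T ≤ c₂′`) with F7's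
  numeric condition, a length function `len`, a real basis `b` of `M_N(ℂ)` with coordinate bound `M₂`, scalar walk data `Rr, Hp`:
  `∃ a₁ > 0, ∃ a₀′ > 0, ∃ a k₀` (`L^a ≥ 8`), `∀ c_L > 0` with `c_L·L² < a₀′` and `c_L ≤ c_P`, `∃ B₁ B₂ c₁ > 0`, `∀ m K k η` with `1 ≤ k`, `k + k₀ ≤ m + K`, `η > 0`:
  [(α) at every shape-member of level `n ≤ k`] → [(Δa) at every shape-member of level `m′ ≤ k`] → `Thm2SetupSUAt (PV d ℓ m K hd hL) N k η 0 B₁ B₂ c₁ len ⊤`.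
* §2 ★★★★★ `hThm2_of_cubeData_deltaASide` — THE `hThm2` BINDER OF THE 19200 DICTIONARY (`Prop7SPrintThm2Dict.prop2Printed_sPrint_of_thm2SetupSUAt`), for the
  families with `k₀ ≤ F.m + n`: same header at `d + 1 = 3`, `N = 2`; `∃ B₁ B₂ c₁ > 0`, `∀ F : T3Family`, `F.L = ℓ + 1` → `∀ n < K`, `k₀ ≤ F.m + n` → [(α) at
  `(F.m, K, K − n, L^{−(K−n)})`] → [(Δa) likewise] → `∃ β₀ B₂′ len′, Thm2SetupSUAt (F.P K) 2 (K − n) (eta F n K) β₀ B₁ B₂′ c₁ len′ ⊤`.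

HONEST SCOPE ∕ NOT CLAIMED.  Composition BY NAME of landed theorems (G2, F10, r05's arrow, A13's `P_eq_PV`) with threshold bookkeeping; NO estimate of [B8] ∕
[B9] ∕ [4] is proved IN THIS FILE.  The two displayed families are inhabited by nothing here: (α) is [B8] Prop. 6's business (p. 82 «eventually we will drop it
out of the assumptions», p. 99; pub-ymgap's `B8Prop6Reg335ZdAllTorus` proves the `ℤᵈ` class statement — the def-Y per-cube datum for `bgY i U₀` is NOT derived
from it here); (Δa) is the G-B9-LETTERS road (cell gaps G-B9-02 ff.; p38 ∕ p33 lineages).  Located volume threshold `k + k₀ ≤ m + K` (resp. `k₀ ≤ F.m + n`);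
`SU(N)`, `N ≤ 25`; sup-entries only (`β₀ = 0`); DESIGN constants `B*`, `C*`, `c_P`, `B₁` (not printed constants); count-neutral; no summit ∕ sub-problem statement
is proved; NOT a node discharge; `stub_PV3A` NOT discharged; nothing continuum ∕ ℝ⁴ ∕ OS ∕ mass-gap ∕ Clay — the Yang–Mills mass gap is NOT proved by any of this.
No `sorry`, no `axiom`, no `def`, no `instance`, no `notation`.  NEW file; nothing landed is modified.  Cell `lit-balaban`, seat `lit-balaban-t2s-1` gen 9,
2026-08-28; `--supports stmt-QuantumFields-19200`.
-/

noncomputable section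

open scoped BigOperators

namespace Literature.MathematicalPhysics.QuantumFieldTheory.Balaban1983to89.B8Thm2TorusOfCubeDataDeltaASide

open Node00 B6KLevelCensusIndexV1 B9Eq39Adjoint
open B7Prop1Explicit renaming Site → LSite
open B7Prop1Explicit (e)
open B7Prop2Explicit (unitaryUnits C0 c2')
open B4PartitionUnity22 (thetaProf D1)
open B6Cover236MultiLevelBlocks (cubes)
open B6GlobalChartV1 (PV boxEquiv)
open B9BackgroundsKLevelV1 (shiftsV1)
open B9Eq360DeltaPrimeAY (AfldY)
open B9GeoNormsKLevelV1 (geo9K)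
open B9Cor36CubeCutoffs (SC NearC)
open B8Ineq132 (InAk)
open B8LeafModelZd (ZdIdx)
open B8Thm2TorusLettersPerOfKnit (bgY)
open B9B8AveragingJunction (parKnitY)
open B9SupplySockB9P3ZdLetters (OpsZd)
open B9Eq316AveragingTransposeZd (qQ betaTau alphaQ)
open B7Prop2SpecialUnitary (specialUnitaryUnits)
open B8Thm2SetupTorus (Thm2SetupSUAt)
open B8Thm2TorusKnitOfCubeDataCatalogued (thm2SetupSUAt_ofCubeData_catalogued_exists)
open B9B8KnitTorusSocketCatalogued (sockB9P3Per_torus_allLevels_catalogued)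
open B8Eq159TorusPerOfSockB9P3Per (b9Arrow_of_sockB9P3Per)
open B8Thm2T3FamilyBinder (P_eq_PV)
open T3ContinuumYM3Torus (T3Family)
open T3SectALandauChart (eta eta_pos)
open T4TermwiseTorus (IsPeriodic)
open scoped Matrix Matrix.Norms.L2Operator

variable {d ℓ : ℕ} {hd : 1 ≤ d + 1} {hL : Odd (ℓ + 1) ∧ 1 < ℓ + 1}

/-! ## §1 ★★★★★ [B8] Thm 2 at the `SU(N)`-valued Setup-torus objects from the per-cube (3.35) data and the Δ_a-side members -/

section Setup

variable {N : ℕ} [NeZero N]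
variable [instF : ∀ i : KIdx d ℓ hd hL 1 1, Fintype (geo9K i).Site] [instD : ∀ i : KIdx d ℓ hd hL 1 1, DecidableEq (geo9K i).Site]

/-- ★★★★★ **[B8] THM 2 AT THE `SU(N)`-VALUED SETUP-TORUS OBJECTS OF EVERY `PV d ℓ m K` WITH `k + k₀ ≤ m + K`, FROM (α) THE PER-CUBE (3.35) DATA AND (Δa) THE SIX
Δ_a-SIDE MEMBERS OF [B9] §3 AT def-Y's LETTERS ALONE** (`1 ≤ N ≤ 25`, `d + 1 ≥ 2`, odd `L = ℓ + 1 ≥ 5`; `τ = tr` with constant `C_τ`; `B₀ > 0`, `M ≥ 1`, `a_T` in the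
windows with F7's numeric condition; `len`; basis `b`, `M₂`; `Rr, Hp`).  `∃ a₁ > 0, ∃ a₀′ > 0, ∃ a k₀` (`L^a ≥ 8`), `∀ c_L > 0` with `c_L·L² < a₀′`, `c_L ≤ c_P`,
`∃ B₁ B₂ c₁ > 0`, `∀ m K k η` (`1 ≤ k`, `k + k₀ ≤ m + K`, `η > 0`; `P₀ = 2L^{m+K}`): (α) [for every member `i : KIdx d ℓ hd hL 1 1` of constant level `1 ≤ n ≤ k`,
`i.k = n + 1`, `M_h = L^a`, `c_f = L^{n+1}`, period `P₀`, every `0 < α₀ ≤ c_L` and every `SU(N)`-valued `P₀`-periodic `U₀ ∈ 𝔄_n(T_η, α₀)`: per-cube (3.35) data for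
`bgY i U₀` — FILE 16's twelve clauses] → (Δa) [for every member `i : KIdx d ℓ hd hL 1 1` of constant level `1 ≤ m′ ≤ k`, `i.k = m′ + 1`, `c_f = L^{m′+1}`, weights
of record, period `P₀`, every `0 < α₀ ≤ a_T` and every `U(N)`-valued `P₀`-periodic `U₀ ∈ 𝔄_{m′}(T_η, α₀)`: `IsUnit Δ_a`, the three weighted bounds of `G_a` at `B₀`,
`IsUnit Δ′_a`, `IsUnit X` at `U = bgY i U₀`, `parS = parKnitY i`, `parB = parBY i`, `Gp = GpY i (parKnitY i)` — F10's binder verbatim with `K′ = k`] →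
`Thm2SetupSUAt (PV d ℓ m K hd hL) N k η 0 B₁ B₂ c₁ len (fun _ => True)`.  HONEST SCOPE: (α), (Δa) displayed and inhabited by nothing here; G2, F10, r05's arrow
used BY NAME; `stub_PV3A` NOT discharged; the Yang–Mills mass gap is NOT proved.
[cite: Balaban1985RegularSpaces, Thm 2 p.83, (1.33)–(1.39) pp.82–83, p.77 («Ω_j = T_η»), p.76 («G = SU(N)»), (1.58)–(1.60) pp.86–87, Prop. 3 p.87; Balaban1985BackgroundPropagators, (3.35)–(3.37) p.396, Thm 3.1 (3.42) p.397, Thm 3.2 (3.48) p.398, Thm 3.3 p.399, Thm 3.4 p.400, (3.16) p.393, (3.41) p.397, (3.69) p.404, Thm 3.7 pp.409–410, Thm 3.9 p.413, Thm 3.11 p.416; Balaban1984PropagatorsII, (2.1)–(2.4) p.224, (2.16) p.225, Lemma 2.1 pp.233–234; Balaban1985Averaging, (4) p.18, Prop. 2 p.26] -/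
theorem thm2SetupSUAt_ofCubeData_deltaASide_exists (hN : N ≤ 25) (hd2 : 2 ≤ d + 1) (hℓ : 4 ≤ ℓ)
    (τ : Matrix (Fin N) (Fin N) ℂ →ₗ[ℂ] ℂ) (hτ : ∀ a, τ a = Matrix.trace a) (hτt : ∀ a b, τ (a * b) = τ (b * a))
    {Cτ : ℝ} (hCτ : ∀ x y : Matrix (Fin N) (Fin N) ℂ, |(τ (star x * y)).re| ≤ Cτ * ‖x‖ * ‖y‖)
    {M : ℝ} (hM1 : 1 ≤ M) {B₀ aT : ℝ} (hB₀ : 0 < B₀) (haT : 0 < aT) (haTQ : aT ≤ alphaQ (d + 1) (ℓ + 1) / ((ℓ + 1 : ℕ) : ℝ) ^ 2)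
    (haT3 : C0 (d + 1) * aT ≤ 1 / 3) (haT2 : 2 * aT ≤ c2' (d + 1) (ℓ + 1))
    (hεB : 2 * ((48 * ((d : ℝ) + 1) + 14 * d * M + (32 * ((d : ℝ) + 2) ^ 2 +
        12 * ((d : ℝ) + 1) ^ 2 * (13344 * ((d : ℝ) + 1) * ((d : ℝ) + 2) ^ 2 * ((d : ℝ) + 5) * (((ℓ + 1 : ℕ) : ℝ)) ^ (d + 4)) *
          (Cτ * (letI : CStarAlgebra (Matrix (Fin N) (Fin N) ℂ) := {}; betaTau τ)))) * aT) * B₀ ≤ 1)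
    {len : LSite (d + 1) → ℝ}
    {ι : Type} [Fintype ι] [DecidableEq ι] (b : Module.Basis ι ℝ (Matrix (Fin N) (Fin N) ℂ)) {M₂ : ℝ} (hM₂ : 0 ≤ M₂)
    (hrepr : ∀ (v : Matrix (Fin N) (Fin N) ℂ) (j : ι), |b.repr v j| ≤ M₂ * ‖v‖) (Rr : ℝ) (Hp : Prop) :
    letI : CStarAlgebra (Matrix (Fin N) (Fin N) ℂ) := {}
    ∃ a₁ : ℝ, 0 < a₁ ∧ ∃ a₀' : ℝ, 0 < a₀' ∧ ∃ a k₀ : ℕ, 8 ≤ (ℓ + 1) ^ a ∧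
    ∀ cL : ℝ, 0 < cL → cL * (((ℓ + 1 : ℕ) : ℝ)) ^ 2 < a₀' →
      cL ≤ min (1 / 16) (min aT (min aT (1 / (2 * (2 * B₀) * (14 * ((d + 1 - 1 : ℕ) : ℝ)) * M + 1)))) →
    ∃ B₁ B₂ c₁ : ℝ, 0 < B₁ ∧ 0 < B₂ ∧ 0 < c₁ ∧ ∀ (m K k : ℕ) (η : ℝ), 1 ≤ k → k + k₀ ≤ m + K → 0 < η →
      (∀ (i : KIdx d ℓ hd hL 1 1) (n : ℕ), 1 ≤ n → n ≤ k → (∀ x, i.D.lev x = n) → i.k = n + 1 → i.Mh = (ℓ + 1) ^ a →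
        i.cf = (((ℓ + 1 : ℕ) : ℝ)) ^ (n + 1) → (PV d ℓ i.m i.K hd hL).sitesPerDir 0 = (PV d ℓ m K hd hL).sitesPerDir 0 →
        ∀ ⦃α₀ : ℝ⦄, 0 < α₀ → α₀ ≤ cL → ∀ U₀ : LSite (d + 1) → Fin (d + 1) → (Matrix (Fin N) (Fin N) ℂ)ˣ,
          (∀ x κ, U₀ x κ ∈ specialUnitaryUnits (Fin N)) →
          (∀ (x : LSite (d + 1)) (μ : Fin (d + 1)), U₀ (x + (((PV d ℓ m K hd hL).sitesPerDir 0 : ℕ) : ℤ) • e μ) = U₀ x) →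
          InAk (ℓ + 1) n η α₀ (fun _ => (Set.univ : Set (LSite (d + 1)))) U₀ →
          ∃ (g : ↥(cubes (toKT i).D.toDomains) → GaugeY (Matrix (Fin N) (Fin N) ℂ) i)
            (A : ↥(cubes (toKT i).D.toDomains) → AfldY (Matrix (Fin N) (Fin N) ℂ) i)
            (Q : ↥(cubes (toKT i).D.toDomains) → Set (Site (PV d ℓ i.m i.K hd hL) 0))
            (C ξ Λ : ↥(cubes (toKT i).D.toDomains) → ℝ),
            (∀ c x, ‖(g c x : Matrix (Fin N) (Fin N) ℂ)‖ ≤ 1 ∧ ‖(((g c x)⁻¹ : (Matrix (Fin N) (Fin N) ℂ)ˣ) : Matrix (Fin N) (Fin N) ℂ)‖ ≤ 1) ∧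
            (∀ c, 0 ≤ C c) ∧ (∀ c, 0 < ξ c) ∧ (∀ c, 1 ≤ Λ c) ∧ (∀ c, ξ c ≤ 5 * (SC i c : ℝ) * (kGeo i).eta) ∧
            (∀ c, LatticeNorms.scaleLen ((ℓ : ℝ) + 1) (kGeo i).eta (c.1.1 + 1) ≤ Λ c * ξ c) ∧
            (∀ c, ∀ x : Site (PV d ℓ i.m i.K hd hL) 0, NearC i c (35 * SC i c / 8 + 1) (boxEquiv i.hN x).1 → x ∈ Q c) ∧
            (∀ c, ∀ (κ : Fin (d + 1)) (x : Site (PV d ℓ i.m i.K hd hL) 0), x ∈ Q c → x.shift κ ∈ Q c →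
              gaugeY i (g c) (bgY i U₀) κ x = fluct (kGeo i).eta (A c) κ x) ∧
            (∀ c, ∀ κ, ∀ x ∈ Q c, ‖A c κ x‖ ≤ C c * (ξ c)⁻¹) ∧
            (∀ c, ∀ μ ν, ∀ x ∈ Q c,
              ‖(((kGeo i).eta : ℂ)⁻¹) • covD (shiftsV1 (PV d ℓ i.m i.K hd hL)) (fun _ _ => (1 : (Matrix (Fin N) (Fin N) ℂ)ˣ)) μ (A c ν) x‖ ≤
                C c * (ξ c ^ 2)⁻¹) ∧
            (∀ c, max (C c) (C c * (1 + D1 thetaProf)) * Λ c ^ 2 ≤ a₁) ∧ (∀ c, max (C c) (C c * (1 + D1 thetaProf)) * Λ c ^ 2 ≤ 1 / 4)) →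
      (∀ (i : KIdx d ℓ hd hL 1 1) (m' : ℕ), 1 ≤ m' → m' ≤ k → i.k = m' + 1 → (∀ x, i.D.lev x = m') →
        i.cf = (((ℓ + 1 : ℕ) : ℝ)) ^ (m' + 1) →
        (∀ ι : IBondY i, i.w ι = i.cf ^ 2 * (((((ℓ + 1 : ℕ) : ℝ)) ^ (ι.1.1 : ℕ)) ^ (d + 1) * (1 / (((ℓ + 1 : ℕ) : ℝ)) ^ (ι.1.1 : ℕ)) ^ 2)) →
        (PV d ℓ i.m i.K hd hL).sitesPerDir 0 = (PV d ℓ m K hd hL).sitesPerDir 0 →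
        ∀ (α₀ : ℝ) (U₀ : LSite (d + 1) → Fin (d + 1) → (Matrix (Fin N) (Fin N) ℂ)ˣ),
        (∀ x κ, U₀ x κ ∈ B7Prop2Explicit.unitaryUnits (Matrix (Fin N) (Fin N) ℂ)) →
        IsPeriodic ((PV d ℓ m K hd hL).sitesPerDir 0) U₀ → 0 < α₀ → α₀ ≤ aT →
        InAk (ℓ + 1) m' η α₀ (fun _ => (Set.univ : Set (LSite (d + 1)))) U₀ →
          IsUnit (deltaAY i (parKnitY i) (parBY i) (GpY i (parKnitY i)) (bgY i U₀)) ∧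
          (∀ F, wNormBY i (-1) (GAY i (parKnitY i) (parBY i) (GpY i (parKnitY i)) (bgY i U₀) F) ≤ B₀ * wNormBY i (-3) F) ∧
          (∀ F ν, wNormBY i (-2) (cdB i (bgY i U₀) ν (GAY i (parKnitY i) (parBY i) (GpY i (parKnitY i)) (bgY i U₀) F)) ≤ B₀ * wNormBY i (-3) F) ∧
          (∀ F, wNormBY i (-3) (lapB i (bgY i U₀) (GAY i (parKnitY i) (parBY i) (GpY i (parKnitY i)) (bgY i U₀) F)) ≤ B₀ * wNormBY i (-3) F) ∧
          IsUnit (deltaPrimeAY i (parKnitY i) (bgY i U₀)) ∧ IsUnit (XY i (parKnitY i) (GpY i (parKnitY i)) (bgY i U₀))) →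
      Thm2SetupSUAt (PV d ℓ m K hd hL) N k η 0 B₁ B₂ c₁ len (fun _ => True) := by
  letI : CStarAlgebra (Matrix (Fin N) (Fin N) ℂ) := {}
  have hL1 : 1 ≤ ℓ + 1 := by omega
  -- the (B)-line constants served by F10's socket
  set Bs : ℝ := max (max 1 (2 * (2 * B₀) * max 1 (qQ (d + 1) (ℓ + 1) Cτ (betaTau τ) 0))) (max 2 (4 * ((d + 1 : ℕ) : ℝ))) with hBs
  set Cs : ℝ := max (2 * max 0 (2 * (2 * B₀)) * max 1 (qQ (d + 1) (ℓ + 1) Cτ (betaTau τ) 0)) 4 with hCs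
  set cP : ℝ := min (1 / 16) (min aT (min aT (1 / (2 * (2 * B₀) * (14 * ((d + 1 - 1 : ℕ) : ℝ)) * M + 1)))) with hcP
  have hBs2 : 2 ≤ Bs := (le_max_left _ _).trans (le_max_right _ _)
  have hBs0 : 0 < Bs := lt_of_lt_of_le two_pos hBs2
  have hBs' : 2 ≤ 5 * ((d + 1 : ℕ) : ℝ) * ((ℓ + 1 : ℕ) : ℝ) * Bs := by
    have h1 : (1 : ℝ) ≤ ((d + 1 : ℕ) : ℝ) := by exact_mod_cast Nat.succ_le_succ (Nat.zero_le d)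
    have h2 : (1 : ℝ) ≤ ((ℓ + 1 : ℕ) : ℝ) := by exact_mod_cast hL1
    have h3 : (2 : ℝ) ≤ ((d + 1 : ℕ) : ℝ) * ((ℓ + 1 : ℕ) : ℝ) * Bs := by
      have := mul_le_mul (mul_le_mul h1 h2 zero_le_one (zero_le_one.trans h1)) hBs2 zero_le_two (by positivity)
      simpa using this
    nlinarith
  have hcP0 : 0 < cP := by
    have hM0 : 0 < 2 * (2 * B₀) * (14 * ((d + 1 - 1 : ℕ) : ℝ)) * M + 1 := by
      have : 0 ≤ 2 * (2 * B₀) * (14 * ((d + 1 - 1 : ℕ) : ℝ)) * M := by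
        have := hB₀.le; have : (0 : ℝ) ≤ M := le_trans zero_le_one hM1; positivity
      linarith
    refine lt_min (by norm_num) (lt_min haT (lt_min haT (div_pos one_pos hM0)))
  -- G2 at these constants
  obtain ⟨a₁, ha₁, a₀', ha₀', a, k₀, h8, H⟩ :=
    thm2SetupSUAt_ofCubeData_catalogued_exists (hd := hd) (hL := hL) (len := len) (B₀β := Cs) (βH := (0 : ℝ)) hN hd2 hℓ one_pos le_rfl hBs0 hBs'
      hcP0 b hM₂ hrepr Rr Hp
  refine ⟨a₁, ha₁, a₀', ha₀', a, max k₀ 5, h8, fun cL hcL hαe hcLP => ?_⟩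
  obtain ⟨B₁, B₂, c₁, hB₁, hB₂, hc₁, HT⟩ := H cL hcL hαe
  refine ⟨B₁, B₂, c₁, hB₁, hB₂, hc₁, fun m K k η hk hkK hη hdata hΔ => HT m K k η hk (by omega) hη hdata ?_⟩
  -- the (B)-lines from the Δ_a-side members: F10's socket at all truncations `m′ ≤ k`, then r05's guarded arrow at radius `c_L ≤ c_P`
  have h8' : 8 ≤ (ℓ + 1) ^ 2 := by nlinarith
  let ops₀ : ℝ → ZdIdx (d + 1) (ℓ + 1) → ℕ → OpsZd (d + 1) (Matrix (Fin N) (Fin N) ℂ) :=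
    fun _ _ _ => ⟨fun _ A => A, fun _ A => A, fun _ A => A, fun _ A => A⟩
  have hS := sockB9P3Per_torus_allLevels_catalogued (hd := hd) (hL := hL) hℓ hd2 hL1 τ hτ hτt hCτ (m := m) (K := K) (K' := k) (a := 2) h8'
    (by omega) hη (k := 1) le_rfl ops₀ hM1 hB₀ haT haTQ haT3 haT2 hεB hΔ len
  exact b9Arrow_of_sockB9P3Per (cB := cP) (cL := cL) hS le_rfl hcLP

end Setup

/-! ## §2 ★★★★★ The `hThm2` binder of the 19200 dictionary (`d + 1 = 3`, `N = 2`), for the families with `k₀ ≤ F.m + n` -/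

section Binder

variable {hd₃ : 1 ≤ 2 + 1}
variable [instF : ∀ i : KIdx 2 ℓ hd₃ hL 1 1, Fintype (geo9K i).Site] [instD : ∀ i : KIdx 2 ℓ hd₃ hL 1 1, DecidableEq (geo9K i).Site]

/-- ★★★★★ **THE `hThm2` BINDER OF THE 19200 DICTIONARY FROM (α) THE PER-CUBE (3.35) DATA AND (Δa) THE Δ_a-SIDE MEMBERS, FOR THE FAMILIES WITH `k₀ ≤ F.m + n`**:
§1 at `d + 1 = 3`, `N = 2`, read at `(m, K, k, η) := (F.m, K, K − n, L^{−(K−n)})` through `F.P K = PV 2 ℓ F.m K` (`B8Thm2T3FamilyBinder.P_eq_PV`): the same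
existential header, then `∃ B₁ B₂ c₁ > 0` such that for every `F : T3Family` with `F.L = ℓ + 1`, every `n < K` with `k₀ ≤ F.m + n`: (α) → (Δa) →
`∃ β₀ B₂′ len′, Thm2SetupSUAt (F.P K) 2 (K − n) (eta F n K) β₀ B₁ B₂′ c₁ len′ (fun _ => True)` — the hypothesis of
`Prop7SPrintThm2Dict.prop2Printed_sPrint_of_thm2SetupSUAt` for those families, modulo the two displayed analytic families.  HONEST SCOPE as §1; the volume
threshold stands; `stub_PV3A` NOT discharged; the Yang–Mills mass gap is NOT proved.
[cite: Balaban1985RegularSpaces, Thm 2 p.83, (1.33)–(1.39) pp.82–83, p.77 («Ω_j = T_η»), p.76; Balaban1985BackgroundPropagators, (3.35)–(3.37) p.396, Thm 3.3 p.399, Thm 3.4 p.400, Thm 3.11 p.416; Balaban1985UV3, (1)–(3) p.256; Balaban1984PropagatorsII, (2.1)–(2.4) p.224] -/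
theorem hThm2_of_cubeData_deltaASide (hℓ : 4 ≤ ℓ)
    (τ : Matrix (Fin 2) (Fin 2) ℂ →ₗ[ℂ] ℂ) (hτ : ∀ a, τ a = Matrix.trace a) (hτt : ∀ a b, τ (a * b) = τ (b * a))
    {Cτ : ℝ} (hCτ : ∀ x y : Matrix (Fin 2) (Fin 2) ℂ, |(τ (star x * y)).re| ≤ Cτ * ‖x‖ * ‖y‖)
    {M : ℝ} (hM1 : 1 ≤ M) {B₀ aT : ℝ} (hB₀ : 0 < B₀) (haT : 0 < aT) (haTQ : aT ≤ alphaQ (2 + 1) (ℓ + 1) / ((ℓ + 1 : ℕ) : ℝ) ^ 2)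
    (haT3 : C0 (2 + 1) * aT ≤ 1 / 3) (haT2 : 2 * aT ≤ c2' (2 + 1) (ℓ + 1))
    (hεB : 2 * ((48 * (((2 : ℕ) : ℝ) + 1) + 14 * ((2 : ℕ) : ℝ) * M + (32 * (((2 : ℕ) : ℝ) + 2) ^ 2 +
        12 * (((2 : ℕ) : ℝ) + 1) ^ 2 * (13344 * (((2 : ℕ) : ℝ) + 1) * (((2 : ℕ) : ℝ) + 2) ^ 2 * (((2 : ℕ) : ℝ) + 5) * (((ℓ + 1 : ℕ) : ℝ)) ^ (2 + 4)) *
          (Cτ * (letI : CStarAlgebra (Matrix (Fin 2) (Fin 2) ℂ) := {}; betaTau τ)))) * aT) * B₀ ≤ 1)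
    {len : LSite (2 + 1) → ℝ}
    {ι : Type} [Fintype ι] [DecidableEq ι] (b : Module.Basis ι ℝ (Matrix (Fin 2) (Fin 2) ℂ)) {M₂ : ℝ} (hM₂ : 0 ≤ M₂)
    (hrepr : ∀ (v : Matrix (Fin 2) (Fin 2) ℂ) (j : ι), |b.repr v j| ≤ M₂ * ‖v‖) (Rr : ℝ) (Hp : Prop) :
    letI : CStarAlgebra (Matrix (Fin 2) (Fin 2) ℂ) := {}
    ∃ a₁ : ℝ, 0 < a₁ ∧ ∃ a₀' : ℝ, 0 < a₀' ∧ ∃ a k₀ : ℕ, 8 ≤ (ℓ + 1) ^ a ∧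
    ∀ cL : ℝ, 0 < cL → cL * (((ℓ + 1 : ℕ) : ℝ)) ^ 2 < a₀' →
      cL ≤ min (1 / 16) (min aT (min aT (1 / (2 * (2 * B₀) * (14 * ((2 + 1 - 1 : ℕ) : ℝ)) * M + 1)))) →
    ∃ B₁ B₂ c₁ : ℝ, 0 < B₁ ∧ 0 < B₂ ∧ 0 < c₁ ∧
    ∀ F : T3Family, F.L = ℓ + 1 → ∀ (n K : ℕ), n < K → k₀ ≤ F.m + n →
      (∀ (i : KIdx 2 ℓ hd₃ hL 1 1) (n' : ℕ), 1 ≤ n' → n' ≤ K - n → (∀ x, i.D.lev x = n') → i.k = n' + 1 → i.Mh = (ℓ + 1) ^ a →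
        i.cf = (((ℓ + 1 : ℕ) : ℝ)) ^ (n' + 1) → (PV 2 ℓ i.m i.K hd₃ hL).sitesPerDir 0 = (PV 2 ℓ F.m K hd₃ hL).sitesPerDir 0 →
        ∀ ⦃α₀ : ℝ⦄, 0 < α₀ → α₀ ≤ cL → ∀ U₀ : LSite (2 + 1) → Fin (2 + 1) → (Matrix (Fin 2) (Fin 2) ℂ)ˣ,
          (∀ x κ, U₀ x κ ∈ specialUnitaryUnits (Fin 2)) →
          (∀ (x : LSite (2 + 1)) (μ : Fin (2 + 1)), U₀ (x + (((PV 2 ℓ F.m K hd₃ hL).sitesPerDir 0 : ℕ) : ℤ) • e μ) = U₀ x) →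
          InAk (ℓ + 1) n' (eta F n K) α₀ (fun _ => (Set.univ : Set (LSite (2 + 1)))) U₀ →
          ∃ (g : ↥(cubes (toKT i).D.toDomains) → GaugeY (Matrix (Fin 2) (Fin 2) ℂ) i)
            (A : ↥(cubes (toKT i).D.toDomains) → AfldY (Matrix (Fin 2) (Fin 2) ℂ) i)
            (Q : ↥(cubes (toKT i).D.toDomains) → Set (Site (PV 2 ℓ i.m i.K hd₃ hL) 0))
            (C ξ Λ : ↥(cubes (toKT i).D.toDomains) → ℝ),
            (∀ c x, ‖(g c x : Matrix (Fin 2) (Fin 2) ℂ)‖ ≤ 1 ∧ ‖(((g c x)⁻¹ : (Matrix (Fin 2) (Fin 2) ℂ)ˣ) : Matrix (Fin 2) (Fin 2) ℂ)‖ ≤ 1) ∧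
            (∀ c, 0 ≤ C c) ∧ (∀ c, 0 < ξ c) ∧ (∀ c, 1 ≤ Λ c) ∧ (∀ c, ξ c ≤ 5 * (SC i c : ℝ) * (kGeo i).eta) ∧
            (∀ c, LatticeNorms.scaleLen ((ℓ : ℝ) + 1) (kGeo i).eta (c.1.1 + 1) ≤ Λ c * ξ c) ∧
            (∀ c, ∀ x : Site (PV 2 ℓ i.m i.K hd₃ hL) 0, NearC i c (35 * SC i c / 8 + 1) (boxEquiv i.hN x).1 → x ∈ Q c) ∧
            (∀ c, ∀ (κ : Fin (2 + 1)) (x : Site (PV 2 ℓ i.m i.K hd₃ hL) 0), x ∈ Q c → x.shift κ ∈ Q c →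
              gaugeY i (g c) (bgY i U₀) κ x = fluct (kGeo i).eta (A c) κ x) ∧
            (∀ c, ∀ κ, ∀ x ∈ Q c, ‖A c κ x‖ ≤ C c * (ξ c)⁻¹) ∧
            (∀ c, ∀ μ ν, ∀ x ∈ Q c,
              ‖(((kGeo i).eta : ℂ)⁻¹) • covD (shiftsV1 (PV 2 ℓ i.m i.K hd₃ hL)) (fun _ _ => (1 : (Matrix (Fin 2) (Fin 2) ℂ)ˣ)) μ (A c ν) x‖ ≤
                C c * (ξ c ^ 2)⁻¹) ∧
            (∀ c, max (C c) (C c * (1 + D1 thetaProf)) * Λ c ^ 2 ≤ a₁) ∧ (∀ c, max (C c) (C c * (1 + D1 thetaProf)) * Λ c ^ 2 ≤ 1 / 4)) →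
      (∀ (i : KIdx 2 ℓ hd₃ hL 1 1) (m' : ℕ), 1 ≤ m' → m' ≤ K - n → i.k = m' + 1 → (∀ x, i.D.lev x = m') →
        i.cf = (((ℓ + 1 : ℕ) : ℝ)) ^ (m' + 1) →
        (∀ ι : IBondY i, i.w ι = i.cf ^ 2 * (((((ℓ + 1 : ℕ) : ℝ)) ^ (ι.1.1 : ℕ)) ^ (2 + 1) * (1 / (((ℓ + 1 : ℕ) : ℝ)) ^ (ι.1.1 : ℕ)) ^ 2)) →
        (PV 2 ℓ i.m i.K hd₃ hL).sitesPerDir 0 = (PV 2 ℓ F.m K hd₃ hL).sitesPerDir 0 →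
        ∀ (α₀ : ℝ) (U₀ : LSite (2 + 1) → Fin (2 + 1) → (Matrix (Fin 2) (Fin 2) ℂ)ˣ),
        (∀ x κ, U₀ x κ ∈ B7Prop2Explicit.unitaryUnits (Matrix (Fin 2) (Fin 2) ℂ)) →
        IsPeriodic ((PV 2 ℓ F.m K hd₃ hL).sitesPerDir 0) U₀ → 0 < α₀ → α₀ ≤ aT →
        InAk (ℓ + 1) m' (eta F n K) α₀ (fun _ => (Set.univ : Set (LSite (2 + 1)))) U₀ →
          IsUnit (deltaAY i (parKnitY i) (parBY i) (GpY i (parKnitY i)) (bgY i U₀)) ∧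
          (∀ F', wNormBY i (-1) (GAY i (parKnitY i) (parBY i) (GpY i (parKnitY i)) (bgY i U₀) F') ≤ B₀ * wNormBY i (-3) F') ∧
          (∀ F' ν, wNormBY i (-2) (cdB i (bgY i U₀) ν (GAY i (parKnitY i) (parBY i) (GpY i (parKnitY i)) (bgY i U₀) F')) ≤ B₀ * wNormBY i (-3) F') ∧
          (∀ F', wNormBY i (-3) (lapB i (bgY i U₀) (GAY i (parKnitY i) (parBY i) (GpY i (parKnitY i)) (bgY i U₀) F')) ≤ B₀ * wNormBY i (-3) F') ∧
          IsUnit (deltaPrimeAY i (parKnitY i) (bgY i U₀)) ∧ IsUnit (XY i (parKnitY i) (GpY i (parKnitY i)) (bgY i U₀))) →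
      ∃ (β₀ B₂' : ℝ) (len' : LSite (F.P K).d → ℝ),
        Thm2SetupSUAt (F.P K) 2 (K - n) (eta F n K) β₀ B₁ B₂' c₁ len' (fun _ => True) := by
  letI : CStarAlgebra (Matrix (Fin 2) (Fin 2) ℂ) := {}
  obtain ⟨a₁, ha₁, a₀', ha₀', a, k₀, h8, H⟩ :=
    thm2SetupSUAt_ofCubeData_deltaASide_exists (d := 2) (hd := hd₃) (hL := hL) (len := len) (by norm_num) (by norm_num) hℓ τ hτ hτt hCτ hM1 hB₀
      haT haTQ haT3 haT2 hεB b hM₂ hrepr Rr Hp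
  refine ⟨a₁, ha₁, a₀', ha₀', a, k₀, h8, fun cL hcL hαe hcLP => ?_⟩
  obtain ⟨B₁, B₂, c₁, hB₁, hB₂, hc₁, HT⟩ := H cL hcL hαe hcLP
  refine ⟨B₁, B₂, c₁, hB₁, hB₂, hc₁, fun F hF n K hnK hm hdata hΔ => ?_⟩
  have hT : Thm2SetupSUAt (PV 2 ℓ F.m K hd₃ hL) 2 (K - n) (eta F n K) 0 B₁ B₂ c₁ len (fun _ => True) :=
    HT F.m K (K - n) (eta F n K) (by omega) (by omega) (eta_pos F n K) hdata hΔ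
  rw [P_eq_PV (hd := hd₃) (hL := hL) F hF K]
  exact ⟨0, B₂, len, hT⟩

end Binder

end Literature.MathematicalPhysics.QuantumFieldTheory.Balaban1983to89.B8Thm2TorusOfCubeDataDeltaASide

end
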